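import Summits.BirchSwinnertonDyer.BirchSwinnertonDyer.Theorems.KolyvaginDepthDoorDepthTableJLSRows
import HarnessLib

/-!
# Route `KolyvaginDepthDoor` — the depth table's CALIBRATION ROWS FILLED BY PRINT (2/2): rows `709a1`,
# `718b1` at `(p, d_K, ℓ) = (3, −7, 5)` and the three rows together (crux `KolyvaginDepthSupply`,
# stmt-BirchSwinnertonDyer-21765)

Helper file (`--supports stmt-BirchSwinnertonDyer-21765 --as helper`); it closes nothing and BSD is
not proved by it. Sequel of `KolyvaginDepthDoorDepthTableJLSRows` (module docstring there: honest
framing, sources, what is proved in the kernel and what is cited). Here: the rows `709a1 = [0,−1,1,−2,0]`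
(`N = Δ = 709`) and `718b1 = [1,0,1,−5,0]` (`N = 2·359`, `Δ = 2⁴·359`) of Jetchev–Lauter–Stein's
Remark 3.11 — per curve: `3 ∈ B(E)` (`ρ̄_{E,3^m}` onto for all `m`: semistable + Frobenius witness at
`q = 11`, resp. `17` + the multiplicative prime `709`, resp. `359 ∥ Δ`), `3` good ordinary, `5` a
Kolyvagin prime for `d_K = −7` with `M(5) ≥ 1`, and the FILLED ROW `jlsRow_3_neg7_5`
(`t_3 = 0 ∧ rank = 2 ∧ s_3 = 2 ∧ s_3(E^{(−7)}) = 1` modulo Kolyvagin 1991 Thm. 4 in printed form `hK`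
and the JLS computation `hJ`) — and `jlsRows_shaCorank_three_eq_zero`, the three calibration rows as
one theorem with the field binder discharged. Calibration at `p = 3` (the crux wants `p ≥ 5`); not a
class theorem; BSD is not proved by any of this.

References: [JetchevLauterStein2009] §3.6 Prop. 3.10, Rem. 3.11 (arXiv:0707.0032 p. 8);
[Kolyvagin1991MathAnn] §1, §2 Thm. 4; [Serre1972] §5.4 Prop. 21; [SerreAbelianLadic1968] IV §3.4;
[Mazur1978] Prop. 6.3 (1); [WZhang2014] Notations (xii); [CremonaAlgorithms1997] Table 1;
[Marcus1977] Ch. 2 Thm. 1.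
-/

-- D-0017: single-problem summit, `Summit.BirchSwinnertonDyer.BirchSwinnertonDyer.…` repeats a
-- namespace component by design.
set_option linter.dupNamespace false

noncomputable section

open scoped Classical NumberField

namespace Summit.BirchSwinnertonDyer.BirchSwinnertonDyer.Theorems.KolyvaginDepthDoor

open Literature.NumberTheory.EllipticCurves Literature.NumberTheory.EllipticCurves.ModularForms
  WeierstrassCurve
open Summit.BirchSwinnertonDyer.BirchSwinnertonDyer.Rank2Observatory
open Summit.BirchSwinnertonDyer.BirchSwinnertonDyer.Rank1Residual
open Summit.BirchSwinnertonDyer.Rank1Residual.Additive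

/-! ## Row `709a1` = `[0,-1,1,-2,0]` (`N = Δ = 709`) at `(p, d_K, ℓ) = (3, -7, 5)` -/

namespace C709a1.AtThree

/-- `#Ẽ(𝔽_3) = 5`, `a_3 = -1` (`3` ordinary) for `709a1`, kernel-decided. [cite: CremonaAlgorithms1997, Table 1 (709a1)] -/
theorem card_3 :
    Nat.card (((⟨0, -1, 1, -2, 0⟩ : WeierstrassCurve ℤ).map (Int.castRingHom (ZMod 3))).toAffine.Point)
      = 5 := by
  rw [PointCountNat.natCard_point_map_eq (hℓ := ⟨by norm_num⟩) (by norm_num) 0 (-1) 1 (-2) 0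
    (by decide +kernel)]
  decide +kernel

/-- `#Ẽ(𝔽_11) = 13`, `a_11 = -1` for `709a1` (irreducibility witness at `p = 3`: `X² + X + 11` has no
root mod `3`), kernel-decided. [cite: CremonaAlgorithms1997, Table 1 (709a1)] -/
theorem card_11 :
    Nat.card (((⟨0, -1, 1, -2, 0⟩ : WeierstrassCurve ℤ).map (Int.castRingHom (ZMod 11))).toAffine.Point)
      = 13 := by
  rw [PointCountNat.natCard_point_map_eq (hℓ := ⟨by norm_num⟩) (by norm_num) 0 (-1) 1 (-2) 0
    (by decide +kernel)]
  decide +kernel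

/-- **`3 ∈ B(709a1)`: `ρ̄_{E,3^m}` is onto for every `m`** (unconditional): semistable, `X² − a_11 X + 11`
(`a_11 = -1`) root-free mod `3`, and the multiplicative prime `709 ∥ Δ`.
[cite: Serre1972, §5.4 Prop. 21] [cite: SerreAbelianLadic1968, Ch. IV §3.4] -/
theorem hasSurjectiveModNGaloisRep_pow_3 (m : ℕ) :
    ((⟨0, -1, 1, -2, 0⟩ : WeierstrassCurve ℤ).map (Int.castRingHom ℚ)).HasSurjectiveModNGaloisRep
      (3 ^ m : ℕ) := by
  have hn : ∀ t : ZMod 3, t ^ 2 - (((11 : ℕ) : ℤ) + 1 - (13 : ℕ) : ℤ) * t + ((11 : ℕ) : ZMod 3) ≠ 0 := by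
    decide +kernel
  haveI := Fact.mk (by norm_num : Nat.Prime 3)
  haveI := Fact.mk (by norm_num : Nat.Prime 11)
  haveI := isElliptic_c709a1
  haveI := isGloballyMinimal_c709a1
  exact hasSurjectiveModNGaloisRep_pow_of_intModel_certificate C709a1.intModel
    (by rw [Int.isCoprime_iff_gcd_eq_one]; decide +kernel) 3 11 (by norm_num) (by decide +kernel)
    (n := 13) card_11 hn 709 (by norm_num) (by norm_num) (by decide +kernel) (by decide +kernel)
    (e := 1) (by decide +kernel) (by decide +kernel) (by decide +kernel) m

/-- **`3` is a prime of good ORDINARY reduction for `709a1`** (`3 ∤ Δ = 709`, `a_3 = -1`).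
[cite: CremonaAlgorithms1997, Table 1 (709a1)] -/
theorem goodOrdinary_3 :
    haveI := Fact.mk (by norm_num : Nat.Prime 3);
    haveI := isGloballyMinimal_c709a1;
    ((⟨0, -1, 1, -2, 0⟩ : WeierstrassCurve ℤ).map (Int.castRingHom ℚ)).HasGoodReductionAtPrime 3 ∧
      ¬ ((3 : ℕ) : ℤ) ∣ ((⟨0, -1, 1, -2, 0⟩ : WeierstrassCurve ℤ).map (Int.castRingHom ℚ)).frobeniusTrace 3 := by
  haveI := Fact.mk (by norm_num : Nat.Prime 3)
  haveI := isGloballyMinimal_c709a1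
  exact goodOrdinary_of_intModel_certificate C709a1.intModel 3 (by decide +kernel) (n := 5) card_3
    (by decide +kernel)

/-- **`5` is a Kolyvagin prime for `(709a1, p = 3, d_K = -7)` with `M(5) ≥ 1`** (unconditional):
`5 ∤ 709·7·3`, `(-7/5) = -1`, `3 ∣ 6`, `3 ∣ a_5 = -3`. [cite: WZhang2014, Notations (xii)]
[cite: JetchevLauterStein2009, §3.6 Remark 3.11 (arXiv:0707.0032 p. 8)] -/
theorem isKolyvaginPrime_5_neg7 (K : Type) [Field K] [NumberField K] (hK : IsImaginaryQuadratic K)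
    (hD : NumberField.discr K = -7) :
    haveI := Fact.mk (by norm_num : Nat.Prime 3);
    haveI := isGloballyMinimal_c709a1;
    Zhang2014.IsKolyvaginPrime
        (((⟨0, -1, 1, -2, 0⟩ : WeierstrassCurve ℤ).map (Int.castRingHom ℚ)).conductorNorm ℤ)
        ((⟨0, -1, 1, -2, 0⟩ : WeierstrassCurve ℤ).map (Int.castRingHom ℚ)) K 3 5 ∧
      (1 : ℕ∞) ≤ Zhang2014.levelIndex ((⟨0, -1, 1, -2, 0⟩ : WeierstrassCurve ℤ).map (Int.castRingHom ℚ)) 3 5 := by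
  haveI := Fact.mk (by norm_num : Nat.Prime 3)
  haveI := isElliptic_c709a1
  haveI := isGloballyMinimal_c709a1
  exact isKolyvaginPrime_of_intModel_certificate C709a1.intModel 3 K hK.1 hD 5 (by norm_num)
    (by norm_num) (by decide +kernel) (by norm_num) (by norm_num) (by norm_num) (by norm_num) (n := 9)
    C709a1.card_5 (by norm_num)

/-- **JLS ROW `709a1` at `(p, d_K, ℓ) = (3, -7, 5)` — a FILLED depth-table row** (computed bit =
Jetchev–Lauter–Stein Remark 3.11, fact `hJ`; structure theorem = Kolyvagin 1991 Thm. 4, printed form,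
fact `hK`; every side condition — `3 ∈ B(E)`, `3 ∤ N`, Heegner hypothesis for `(709, -7)`, `5`
Kolyvagin, `2 ≤ rank` by `KernelCerts002.C709a1.two_le_rank`, minimality — PROVED in the kernel). For
ANY imaginary quadratic `K` with `d_K = -7`: `corank_{ℤ_3} Ш(E/ℚ)[3^∞] = 0`, `rank_ℤ E(ℚ) = 2`,
`corank Sel_{3^∞}(E/ℚ) = 2`, `corank Sel_{3^∞}(E^{(-7)}/ℚ) = 1`. Calibration (`p = 3 < 5`), not an
instance of the crux; BSD is not proved by it. CONDITIONAL on `hK`, `hJ`.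
[cite: JetchevLauterStein2009, §3.6 Remark 3.11 (arXiv:0707.0032 p. 8)]
[cite: Kolyvagin1991MathAnn, §2 Thm. 4 (= typescript Thm. 2.3)] [cite: CremonaAlgorithms1997, Table 1 (709a1)] -/
theorem jlsRow_3_neg7_5
    (hK : Kolyvagin1991_selmerCorank_of_kolyvaginClass_ne_zero_of_padicSurj)
    (hJ : JetchevLauterStein2009_kolyvaginClass_five_ne_zero_at_three)
    (K : Type) [Field K] [NumberField K] (hIQ : IsImaginaryQuadratic K)
    (hD : NumberField.discr K = -7) :
    ((⟨0, -1, 1, -2, 0⟩ : WeierstrassCurve ℤ).map (Int.castRingHom ℚ)).shaCorank 3 = 0 ∧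
      ((⟨0, -1, 1, -2, 0⟩ : WeierstrassCurve ℤ).map (Int.castRingHom ℚ)).mordellWeilRank = 2 ∧
      ((⟨0, -1, 1, -2, 0⟩ : WeierstrassCurve ℤ).map (Int.castRingHom ℚ)).selmerCorank 3 = 2 ∧
      (((⟨0, -1, 1, -2, 0⟩ : WeierstrassCurve ℤ).map (Int.castRingHom ℚ)).quadraticTwist
        ((-7 : ℤ) : ℚ)).selmerCorank 3 = 1 := by
  haveI := isElliptic_c709a1
  haveI := isGloballyMinimal_c709a1
  haveI : NeZero (((⟨0, -1, 1, -2, 0⟩ : WeierstrassCurve ℤ).map (Int.castRingHom ℚ)).conductorNorm ℤ) :=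
    neZero_conductorNorm_of_isElliptic _
  haveI := Fact.mk (by norm_num : Nat.Prime 3)
  obtain ⟨Dt, β, ι, d, hne⟩ := hJ.2.1 K hIQ hD
  exact depthRow_of_intModel_certificate_padic C709a1.intModel hK KernelCerts002.C709a1.two_le_rank
    3 (by norm_num) (by decide +kernel) hasSurjectiveModNGaloisRep_pow_3 K hIQ hD (by norm_num)
    (by norm_num) (by norm_num) C709a1.heegner_neg7 5 (by norm_num) (by norm_num) (by decide +kernel)
    (by norm_num) (by norm_num) (by norm_num) (by norm_num) (n := 9) C709a1.card_5 (by norm_num)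
    Dt β ι d hne

end C709a1.AtThree

/-! ## Row `718b1` = `[1,0,1,-5,0]` (`N = 718`, `Δ = 2⁴·359`) at `(p, d_K, ℓ) = (3, -7, 5)` -/

namespace C718b1.AtThree

/-- `#Ẽ(𝔽_17) = 13`, `a_17 = 5` for `718b1` (irreducibility witness at `p = 3`: `X² − 5X + 17` has no
root mod `3`), kernel-decided. [cite: CremonaAlgorithms1997, Table 1 (718b1)] -/
theorem card_17 :
    Nat.card (((⟨1, 0, 1, -5, 0⟩ : WeierstrassCurve ℤ).map (Int.castRingHom (ZMod 17))).toAffine.Point)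
      = 13 := by
  rw [PointCountNat.natCard_point_map_eq (hℓ := ⟨by norm_num⟩) (by norm_num) 1 0 1 (-5) 0
    (by decide +kernel)]
  decide +kernel

/-- **`3 ∈ B(718b1)`: `ρ̄_{E,3^m}` is onto for every `m`** (unconditional): semistable
(`gcd(c₄, Δ) = 1`, `N = 2·359`), `X² − a_17 X + 17` (`a_17 = 5`) root-free mod `3`, and the
multiplicative prime `359 ∥ Δ = 2⁴·359`. [cite: Serre1972, §5.4 Prop. 21] [cite: SerreAbelianLadic1968, Ch. IV §3.4] -/
theorem hasSurjectiveModNGaloisRep_pow_3 (m : ℕ) :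
    ((⟨1, 0, 1, -5, 0⟩ : WeierstrassCurve ℤ).map (Int.castRingHom ℚ)).HasSurjectiveModNGaloisRep
      (3 ^ m : ℕ) := by
  have hn : ∀ t : ZMod 3, t ^ 2 - (((17 : ℕ) : ℤ) + 1 - (13 : ℕ) : ℤ) * t + ((17 : ℕ) : ZMod 3) ≠ 0 := by
    decide +kernel
  haveI := Fact.mk (by norm_num : Nat.Prime 3)
  haveI := Fact.mk (by norm_num : Nat.Prime 17)
  haveI := isElliptic_c718b1
  haveI := isGloballyMinimal_c718b1
  exact hasSurjectiveModNGaloisRep_pow_of_intModel_certificate C718b1.intModel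
    (by rw [Int.isCoprime_iff_gcd_eq_one]; decide +kernel) 3 17 (by norm_num) (by decide +kernel)
    (n := 13) card_17 hn 359 (by norm_num) (by norm_num) (by decide +kernel) (by decide +kernel)
    (e := 1) (by decide +kernel) (by decide +kernel) (by decide +kernel) m

/-- **`3` is a prime of good ORDINARY reduction for `718b1`** (`3 ∤ Δ = 5744`, `a_3 = -2`).
[cite: CremonaAlgorithms1997, Table 1 (718b1)] -/
theorem goodOrdinary_3 :
    haveI := Fact.mk (by norm_num : Nat.Prime 3);
    haveI := isGloballyMinimal_c718b1;
    ((⟨1, 0, 1, -5, 0⟩ : WeierstrassCurve ℤ).map (Int.castRingHom ℚ)).HasGoodReductionAtPrime 3 ∧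
      ¬ ((3 : ℕ) : ℤ) ∣ ((⟨1, 0, 1, -5, 0⟩ : WeierstrassCurve ℤ).map (Int.castRingHom ℚ)).frobeniusTrace 3 := by
  haveI := Fact.mk (by norm_num : Nat.Prime 3)
  haveI := isGloballyMinimal_c718b1
  exact goodOrdinary_of_intModel_certificate C718b1.intModel 3 (by decide +kernel) (n := 6)
    C718b1.card_3 (by decide +kernel)

/-- **`5` is a Kolyvagin prime for `(718b1, p = 3, d_K = -7)` with `M(5) ≥ 1`** (unconditional):
`5 ∤ 718·7·3`, `(-7/5) = -1`, `3 ∣ 6`, `3 ∣ a_5 = -3`. [cite: WZhang2014, Notations (xii)]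
[cite: JetchevLauterStein2009, §3.6 Remark 3.11 (arXiv:0707.0032 p. 8)] -/
theorem isKolyvaginPrime_5_neg7 (K : Type) [Field K] [NumberField K] (hK : IsImaginaryQuadratic K)
    (hD : NumberField.discr K = -7) :
    haveI := Fact.mk (by norm_num : Nat.Prime 3);
    haveI := isGloballyMinimal_c718b1;
    Zhang2014.IsKolyvaginPrime
        (((⟨1, 0, 1, -5, 0⟩ : WeierstrassCurve ℤ).map (Int.castRingHom ℚ)).conductorNorm ℤ)
        ((⟨1, 0, 1, -5, 0⟩ : WeierstrassCurve ℤ).map (Int.castRingHom ℚ)) K 3 5 ∧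
      (1 : ℕ∞) ≤ Zhang2014.levelIndex ((⟨1, 0, 1, -5, 0⟩ : WeierstrassCurve ℤ).map (Int.castRingHom ℚ)) 3 5 := by
  haveI := Fact.mk (by norm_num : Nat.Prime 3)
  haveI := isElliptic_c718b1
  haveI := isGloballyMinimal_c718b1
  exact isKolyvaginPrime_of_intModel_certificate C718b1.intModel 3 K hK.1 hD 5 (by norm_num)
    (by norm_num) (by decide +kernel) (by norm_num) (by norm_num) (by norm_num) (by norm_num) (n := 9)
    C718b1.card_5 (by norm_num)

/-- **JLS ROW `718b1` at `(p, d_K, ℓ) = (3, -7, 5)` — a FILLED depth-table row** (computed bit =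
Jetchev–Lauter–Stein Remark 3.11, fact `hJ`; structure theorem = Kolyvagin 1991 Thm. 4, printed form,
fact `hK`; every side condition — `3 ∈ B(E)`, `3 ∤ N = 2·359`, Heegner hypothesis for `(718, -7)`
(`2` and `359` split), `5` Kolyvagin, `2 ≤ rank` by `KernelCerts002.C718b1.two_le_rank`, minimality —
PROVED in the kernel). For ANY imaginary quadratic `K` with `d_K = -7`:
`corank_{ℤ_3} Ш(E/ℚ)[3^∞] = 0`, `rank_ℤ E(ℚ) = 2`, `corank Sel_{3^∞}(E/ℚ) = 2`,
`corank Sel_{3^∞}(E^{(-7)}/ℚ) = 1`. Calibration (`p = 3 < 5`), not an instance of the crux; BSD is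
not proved by it. CONDITIONAL on `hK`, `hJ`.
[cite: JetchevLauterStein2009, §3.6 Remark 3.11 (arXiv:0707.0032 p. 8)]
[cite: Kolyvagin1991MathAnn, §2 Thm. 4 (= typescript Thm. 2.3)] [cite: CremonaAlgorithms1997, Table 1 (718b1)] -/
theorem jlsRow_3_neg7_5
    (hK : Kolyvagin1991_selmerCorank_of_kolyvaginClass_ne_zero_of_padicSurj)
    (hJ : JetchevLauterStein2009_kolyvaginClass_five_ne_zero_at_three)
    (K : Type) [Field K] [NumberField K] (hIQ : IsImaginaryQuadratic K)
    (hD : NumberField.discr K = -7) :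
    ((⟨1, 0, 1, -5, 0⟩ : WeierstrassCurve ℤ).map (Int.castRingHom ℚ)).shaCorank 3 = 0 ∧
      ((⟨1, 0, 1, -5, 0⟩ : WeierstrassCurve ℤ).map (Int.castRingHom ℚ)).mordellWeilRank = 2 ∧
      ((⟨1, 0, 1, -5, 0⟩ : WeierstrassCurve ℤ).map (Int.castRingHom ℚ)).selmerCorank 3 = 2 ∧
      (((⟨1, 0, 1, -5, 0⟩ : WeierstrassCurve ℤ).map (Int.castRingHom ℚ)).quadraticTwist
        ((-7 : ℤ) : ℚ)).selmerCorank 3 = 1 := by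
  haveI := isElliptic_c718b1
  haveI := isGloballyMinimal_c718b1
  haveI : NeZero (((⟨1, 0, 1, -5, 0⟩ : WeierstrassCurve ℤ).map (Int.castRingHom ℚ)).conductorNorm ℤ) :=
    neZero_conductorNorm_of_isElliptic _
  haveI := Fact.mk (by norm_num : Nat.Prime 3)
  obtain ⟨Dt, β, ι, d, hne⟩ := hJ.2.2 K hIQ hD
  exact depthRow_of_intModel_certificate_padic C718b1.intModel hK KernelCerts002.C718b1.two_le_rank
    3 (by norm_num) (by decide +kernel) hasSurjectiveModNGaloisRep_pow_3 K hIQ hD (by norm_num)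
    (by norm_num) (by norm_num) C718b1.heegner_neg7 5 (by norm_num) (by norm_num) (by decide +kernel)
    (by norm_num) (by norm_num) (by norm_num) (by norm_num) (n := 9) C718b1.card_5 (by norm_num)
    Dt β ι d hne

end C718b1.AtThree

/-! ## The three rows together -/

/-- **The route's calibration data set as ONE theorem**: modulo Kolyvagin 1991 Thm. 4 (printed
`B(E)` form, `hK`) and the published computation JLS 2009 Prop. 3.10 / Rem. 3.11 (`hJ`), each of the
three rank-2 curves `389a1`, `709a1`, `718b1` has `corank_{ℤ_3} Ш(E/ℚ)[3^∞] = 0` and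
`rank_ℤ E(ℚ) = corank_{ℤ_3} Sel_{3^∞}(E/ℚ) = 2` — three per-curve certificates by the anticyclotomic
depth door (depth `1 = rank − 1`), an instrument DIFFERENT from the cyclotomic λ-door of
Stein–Wuthrich 2013. Field binder discharged (an imaginary quadratic field of discriminant `-7`
exists: `exists_isImaginaryQuadratic_discr_eq`). Calibration of the depth table at `p = 3`; not an
instance of the crux (`p ≥ 5`); BSD is not proved by it. CONDITIONAL on `hK`, `hJ`.
[cite: JetchevLauterStein2009, §3.6 Prop. 3.10 and Remark 3.11 (arXiv:0707.0032 p. 8)]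
[cite: Kolyvagin1991MathAnn, §2 Thm. 4 (= typescript Thm. 2.3)] -/
theorem jlsRows_shaCorank_three_eq_zero
    (hK : Kolyvagin1991_selmerCorank_of_kolyvaginClass_ne_zero_of_padicSurj)
    (hJ : JetchevLauterStein2009_kolyvaginClass_five_ne_zero_at_three) :
    (((⟨0, 1, 1, -2, 0⟩ : WeierstrassCurve ℤ).map (Int.castRingHom ℚ)).shaCorank 3 = 0 ∧
      ((⟨0, 1, 1, -2, 0⟩ : WeierstrassCurve ℤ).map (Int.castRingHom ℚ)).mordellWeilRank = 2 ∧
      ((⟨0, 1, 1, -2, 0⟩ : WeierstrassCurve ℤ).map (Int.castRingHom ℚ)).selmerCorank 3 = 2) ∧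
    (((⟨0, -1, 1, -2, 0⟩ : WeierstrassCurve ℤ).map (Int.castRingHom ℚ)).shaCorank 3 = 0 ∧
      ((⟨0, -1, 1, -2, 0⟩ : WeierstrassCurve ℤ).map (Int.castRingHom ℚ)).mordellWeilRank = 2 ∧
      ((⟨0, -1, 1, -2, 0⟩ : WeierstrassCurve ℤ).map (Int.castRingHom ℚ)).selmerCorank 3 = 2) ∧
    (((⟨1, 0, 1, -5, 0⟩ : WeierstrassCurve ℤ).map (Int.castRingHom ℚ)).shaCorank 3 = 0 ∧
      ((⟨1, 0, 1, -5, 0⟩ : WeierstrassCurve ℤ).map (Int.castRingHom ℚ)).mordellWeilRank = 2 ∧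
      ((⟨1, 0, 1, -5, 0⟩ : WeierstrassCurve ℤ).map (Int.castRingHom ℚ)).selmerCorank 3 = 2) := by
  obtain ⟨K, _, _, hIQ, hD⟩ := exists_isImaginaryQuadratic_discr_eq (D := -7) (by norm_num)
    (Or.inl ⟨by norm_num, Int.squarefree_natAbs.mp (by decide +kernel), by norm_num⟩)
  obtain ⟨h1, h2, h3, -⟩ := C389a1.AtThree.jlsRow_3_neg7_5 hK hJ K hIQ hD
  obtain ⟨h4, h5, h6, -⟩ := C709a1.AtThree.jlsRow_3_neg7_5 hK hJ K hIQ hD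
  obtain ⟨h7, h8, h9, -⟩ := C718b1.AtThree.jlsRow_3_neg7_5 hK hJ K hIQ hD
  exact ⟨⟨h1, h2, h3⟩, ⟨h4, h5, h6⟩, ⟨h7, h8, h9⟩⟩

end Summit.BirchSwinnertonDyer.BirchSwinnertonDyer.Theorems.KolyvaginDepthDoor

end
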